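import Mathlib
import HarnessLib
import Summits.ValiantsHypothesis.ValiantsHypothesis.Theorems.LacunarySymmetroidMatrixDescartesOsculationLawPeelBranchUnique
import Summits.ValiantsHypothesis.ValiantsHypothesis.Theorems.LacunarySymmetroidMatrixDescartesOsculationLawPeelEndMultiplicity

/-!
# ValiantsHypothesis / LacunarySymmetroid — crux `MatrixDescartes` (stmt-ValiantsHypothesis-18050, V1),
# line `Cruxes/MatrixDescartes/Lines/osculation_law.lean` («osculation-law»), stub `stub_peel` (ALL ranks):
# SEVERAL BRANCHES: ORDERING, COMMON ZERO ENDS, AND THE DEGREE BOUND (rank-free; pieces of (γ4) of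
# NOTE-p7g12-peel-general-r-sizing.md §6)

* **`lt_of_lt_solutions`** — two continuous solutions on `Icc t₀ t₁ ⊆ (0,∞)` (the lower one positive) with `β t* < γ t*` at one
  point satisfy `β < γ` everywhere (no crossing: a crossing point would glue them by `branch_unique_of_hyperbolic`).
* **`succ_le_rootMultiplicity_of_branches_tendsto_zero`** — `k + 1` solutions `β 0 < β 1 < … < β k` on `(α, ω)` all tending
  to `0` at `ω⁻` force `rootMultiplicity 0 (P ω) ≥ k + 1` (via `succ_le_rootMultiplicity_of_collapse` along `t_n → ω⁻`) — the
  multiplicity half of the ZERO-end cost in (γ4).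
* **`card_le_natDegree_of_roots`** — a finset of roots of `P T ≢ 0` has at most `natDegree (P T)` elements (the «for ever»
  components over a large `T` in (γ4)).

Honest framing: rank-free LEMMAS toward the OPEN stub `stub_peel` (all `r`); nothing of the summit is proved; `VP ≠ VNP` is
NOT proved.  No definitions, no named facts.
-/

-- `Summit.ValiantsHypothesis.ValiantsHypothesis.…` is the tree's mandated single-conjunct layout (Sub = Summit).
set_option linter.dupNamespace false

noncomputable section

namespace Summit.ValiantsHypothesis.ValiantsHypothesis.Theorems.LacunarySymmetroidMatrixDescartes

open Polynomial Set Filter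
open MvPolynomial (pderiv)
open scoped BigOperators Topology

namespace OsculationPeel

/-- **Branches do not cross.** [folklore] -/
theorem lt_of_lt_solutions (Φ : MvPolynomial (Fin 2) ℝ) (P : ℝ → ℝ[X])
    (hP : ∀ t b, (P t).eval b = MvPolynomial.eval ![t, b] Φ) (hsplit : ∀ t, 0 < t → (P t).Splits)
    (hfin : {p : Fin 2 → ℝ | 0 < p 0 ∧ 0 < p 1 ∧ MvPolynomial.eval p Φ = 0 ∧
      MvPolynomial.eval p
        (MvPolynomial.X 0 * MvPolynomial.pderiv 0 (MvPolynomial.X 0 * MvPolynomial.pderiv 0 Φ)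
            * (MvPolynomial.X 1 * MvPolynomial.pderiv 1 Φ) ^ 2
          - 2 * (MvPolynomial.X 0 * MvPolynomial.pderiv 0 (MvPolynomial.X 1 * MvPolynomial.pderiv 1 Φ))
            * (MvPolynomial.X 0 * MvPolynomial.pderiv 0 Φ) * (MvPolynomial.X 1 * MvPolynomial.pderiv 1 Φ)
          + MvPolynomial.X 1 * MvPolynomial.pderiv 1 (MvPolynomial.X 1 * MvPolynomial.pderiv 1 Φ)
            * (MvPolynomial.X 0 * MvPolynomial.pderiv 0 Φ) ^ 2) = 0}.Finite)
    (hgp : ∀ p ∈ {p : Fin 2 → ℝ | 0 < p 0 ∧ 0 < p 1 ∧ MvPolynomial.eval p Φ = 0 ∧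
      MvPolynomial.eval p
        (MvPolynomial.X 0 * MvPolynomial.pderiv 0 (MvPolynomial.X 0 * MvPolynomial.pderiv 0 Φ)
            * (MvPolynomial.X 1 * MvPolynomial.pderiv 1 Φ) ^ 2
          - 2 * (MvPolynomial.X 0 * MvPolynomial.pderiv 0 (MvPolynomial.X 1 * MvPolynomial.pderiv 1 Φ))
            * (MvPolynomial.X 0 * MvPolynomial.pderiv 0 Φ) * (MvPolynomial.X 1 * MvPolynomial.pderiv 1 Φ)
          + MvPolynomial.X 1 * MvPolynomial.pderiv 1 (MvPolynomial.X 1 * MvPolynomial.pderiv 1 Φ)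
            * (MvPolynomial.X 0 * MvPolynomial.pderiv 0 Φ) ^ 2) = 0},
        MvPolynomial.eval p (MvPolynomial.pderiv 1 Φ) ≠ 0)
    {β γ : ℝ → ℝ} {t₀ t₁ tstar : ℝ} (ht₀ : 0 < t₀) (hstar : tstar ∈ Icc t₀ t₁)
    (hβ : ContinuousOn β (Icc t₀ t₁)) (hγ : ContinuousOn γ (Icc t₀ t₁))
    (hβpos : ∀ t ∈ Icc t₀ t₁, 0 < β t)
    (hΦβ : ∀ t ∈ Icc t₀ t₁, MvPolynomial.eval ![t, β t] Φ = 0) (hΦγ : ∀ t ∈ Icc t₀ t₁, MvPolynomial.eval ![t, γ t] Φ = 0)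
    (hlt : β tstar < γ tstar) : ∀ t ∈ Icc t₀ t₁, β t < γ t := by
  intro t ht
  by_contra hle
  push Not at hle
  -- a crossing point `u` between `t*` and `t` (IVT on `γ − β`), then uniqueness glues `β = γ`: contradiction at `t*`
  have hcont : ContinuousOn (fun u => γ u - β u) (Icc t₀ t₁) := hγ.sub hβ
  obtain ⟨u, hu, hu0⟩ : ∃ u ∈ Icc t₀ t₁, γ u - β u = 0 := by
    have hmem : (0 : ℝ) ∈ Icc (γ t - β t) (γ tstar - β tstar) := ⟨by linarith, by linarith⟩
    rcases le_total tstar t with h | h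
    · have hc := hcont.mono (Icc_subset_Icc hstar.1 ht.2)
      obtain ⟨u, hu, hu0⟩ := intermediate_value_Icc' h hc hmem
      exact ⟨u, ⟨hstar.1.trans hu.1, hu.2.trans ht.2⟩, hu0⟩
    · have hc := hcont.mono (Icc_subset_Icc ht.1 hstar.2)
      obtain ⟨u, hu, hu0⟩ := intermediate_value_Icc h hc hmem
      exact ⟨u, ⟨ht.1.trans hu.1, hu.2.trans hstar.2⟩, hu0⟩
  have heq := branch_unique_of_hyperbolic Φ P hP hsplit hfin hgp ht₀ hu hβ hγ hβpos hΦβ hΦγ (by linarith) hstar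
  exact absurd heq (ne_of_lt hlt)

/-- **Several branches with a common ZERO end raise the multiplicity.**  `k + 1` continuous solutions
`β 0 < β 1 < ⋯ < β k` (pointwise, as an `ℕ`-indexed chain) on `(α, ω)`, all tending to `0` as `t → ω⁻`, force
`rootMultiplicity 0 (P ω) ≥ k + 1` (`P ω ≢ 0`). [folklore] -/
theorem succ_le_rootMultiplicity_of_branches_tendsto_zero (Φ : MvPolynomial (Fin 2) ℝ) (P : ℝ → ℝ[X])
    (hP : ∀ t b, (P t).eval b = MvPolynomial.eval ![t, b] Φ) {α ω : ℝ} (hαω : α < ω) (hP0 : P ω ≠ 0) {k : ℕ}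
    (β : ℕ → ℝ → ℝ) (hchain : ∀ i, i + 1 < k + 1 → ∀ t ∈ Ioo α ω, β i t < β (i + 1) t)
    (hsol : ∀ i, i < k + 1 → ∀ t ∈ Ioo α ω, MvPolynomial.eval ![t, β i t] Φ = 0)
    (hlim : ∀ i, i < k + 1 → Tendsto (β i) (𝓝[<] ω) (𝓝 0)) :
    k + 1 ≤ (P ω).rootMultiplicity 0 := by
  -- the sequence `t_n = ω - (ω - α)/(n + 2) → ω⁻` inside `(α, ω)`
  set t : ℕ → ℝ := fun n => ω - (ω - α) / (n + 2) with htdef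
  have htI : ∀ n, t n ∈ Ioo α ω := by
    intro n
    have h2 : (2 : ℝ) ≤ n + 2 := by have := (Nat.cast_nonneg n : (0:ℝ) ≤ n); linarith
    have hpos : 0 < (ω - α) / (n + 2) := div_pos (by linarith) (by linarith)
    have hlt : (ω - α) / (n + 2) < ω - α := by
      rw [div_lt_iff₀ (by linarith)]; nlinarith
    exact ⟨by simp only [htdef]; linarith, by simp only [htdef]; linarith⟩
  have ht_tend : Tendsto t atTop (𝓝 ω) := by
    have h1 : Tendsto (fun n : ℕ => (ω - α) / ((n : ℝ) + 2)) atTop (𝓝 0) := by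
      refine tendsto_const_nhds.div_atTop ?_
      exact tendsto_atTop_add_const_right _ 2 tendsto_natCast_atTop_atTop
    have h2 : Tendsto (fun n : ℕ => ω - (ω - α) / ((n : ℝ) + 2)) atTop (𝓝 (ω - 0)) := tendsto_const_nhds.sub h1
    rw [sub_zero] at h2
    exact h2
  have ht_within : Tendsto t atTop (𝓝[<] ω) :=
    tendsto_nhdsWithin_iff.2 ⟨ht_tend, Eventually.of_forall fun n => (htI n).2⟩
  refine succ_le_rootMultiplicity_of_collapse Φ P hP hP0 t ht_tend (fun n i => β i (t n))
    (fun n i hi => hchain i hi (t n) (htI n)) (fun n i hi => ?_) ((hlim 0 (by omega)).comp ht_within)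
    ((hlim k (by omega)).comp ht_within)
  rw [IsRoot, hP]
  exact hsol i hi (t n) (htI n)

/-- **Degree bound**: a finset of roots of a non-zero polynomial has at most `natDegree` elements. [folklore] -/
theorem card_le_natDegree_of_roots (p : ℝ[X]) (hp : p ≠ 0) (F : Finset ℝ) (hF : ∀ x ∈ F, p.IsRoot x) :
    F.card ≤ p.natDegree := by
  classical
  calc F.card ≤ p.roots.toFinset.card :=
        Finset.card_le_card fun x hx => Multiset.mem_toFinset.2 ((mem_roots hp).2 (hF x hx))
    _ ≤ Multiset.card p.roots := Multiset.toFinset_card_le _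
    _ ≤ p.natDegree := card_roots' p

end OsculationPeel

end Summit.ValiantsHypothesis.ValiantsHypothesis.Theorems.LacunarySymmetroidMatrixDescartes

end
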